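import Summits.KontsevichZagierPeriods.KontsevichZagierPeriods.Theses.UnfoldedStokes
import Literature.NumberTheory.Transcendental.KZCalculusProofs
import Literature.NumberTheory.Transcendental.KZMellinFibres

/-!
# `ContinuousCubification` (stmt-KontsevichZagierPeriods-17853) — negative side: the corner obstruction

Landed copy of §B.2 of `Cruxes/ContinuousCubification/Disproof.lean` (cdisprove cycle 1, route
UnfoldedStokes). The EASY normal form — one OPEN-cube representation whose integrand is bounded and
continuous on the open cube (plain cylindrical decomposition + cell flattening of the landed bounded
normal form) — does NOT close up to the crux by passing to the closed cube: the `ℚ`-semialgebraic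
function `2x²/(x²+y²)` is bounded (`∈ [0,2]`) and continuous on the open unit square but agrees with NO
function continuous on the closed square (`not_exists_continuousOn_closedSquare_extension`: along the
diagonal it is `1`, along the parabola `y = x²` it tends to `2`). So the last step of any proof of the
crux is a genuine move (a rule-(2) chart with boundary-vanishing Jacobian, a corner blow-up, or a
`C¹` triangulation), not a null-set bookkeeping. Pure real analysis; no transcendence.

References: M. Kontsevich, D. Zagier, *Periods* (2001), §1.2; J. Bochnak, M. Coste, M.-F. Roy, *Real
Algebraic Geometry* (1998), §2.6 (semialgebraic functions need not extend continuously).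
-/

noncomputable section

namespace Summit.KontsevichZagierPeriods.UnfoldedStokes.ContinuousCubificationNegative

open Set Filter
open scoped Topology
open Literature.NumberTheory.Transcendental
open Literature.ModelTheory.ExponentialFields (IsSemialgebraic)
open MvPolynomial (aeval X C)

/-- The corner function is bounded on the open square: `0 ≤ 2x²/(x²+y²) ≤ 2`. [folklore] -/
theorem corner_mem_Icc (x : Fin 2 → ℝ) (hx : x ∈ Set.pi Set.univ (fun _ : Fin 2 => Set.Ioo (0:ℝ) 1)) :
    2 * x 0 ^ 2 / (x 0 ^ 2 + x 1 ^ 2) ∈ Icc (0:ℝ) 2 := by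
  rw [Set.mem_univ_pi] at hx
  have h0 := (hx 0).1
  have hpos : 0 < x 0 ^ 2 + x 1 ^ 2 := by positivity
  constructor
  · positivity
  · rw [div_le_iff₀ hpos]
    nlinarith [sq_nonneg (x 1)]

/-- The corner function is continuous on the open square (denominator `> 0` there). [folklore] -/
theorem continuousOn_corner :
    ContinuousOn (fun x : Fin 2 → ℝ => 2 * x 0 ^ 2 / (x 0 ^ 2 + x 1 ^ 2))
      (Set.pi Set.univ (fun _ : Fin 2 => Set.Ioo (0:ℝ) 1)) := by
  refine ContinuousOn.div (by fun_prop) (by fun_prop) fun x hx => ?_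
  rw [Set.mem_univ_pi] at hx
  have h0 := (hx 0).1
  positivity

/-- The corner function is `ℚ`-semialgebraic on the open square (a quotient of `ℚ`-polynomials with
non-vanishing denominator; tree `isSemialgebraicFunOn_aeval_div_aeval`). [folklore] -/
theorem isSemialgebraicFunOn_corner :
    IsSemialgebraicFunOn ℚ (Set.pi Set.univ (fun _ : Fin 2 => Set.Ioo (0:ℝ) 1))
      (fun x : Fin 2 → ℝ => 2 * x 0 ^ 2 / (x 0 ^ 2 + x 1 ^ 2)) := by
  have hσ : IsSemialgebraic ℚ (Set.pi Set.univ (fun _ : Fin 2 => Set.Ioo (0:ℝ) 1)) := by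
    have h := KZ.isSemialgebraic_box 2
    convert h using 1
    ext x
    simp
  have hq : ∀ x ∈ Set.pi Set.univ (fun _ : Fin 2 => Set.Ioo (0:ℝ) 1),
      aeval x (X 0 ^ 2 + X 1 ^ 2 : MvPolynomial (Fin 2) ℚ) ≠ 0 := by
    intro x hx
    rw [Set.mem_univ_pi] at hx
    have h0 := (hx 0).1
    simp only [map_add, map_pow, MvPolynomial.aeval_X]
    positivity
  refine (isSemialgebraicFunOn_aeval_div_aeval hσ (C 2 * X 0 ^ 2) (X 0 ^ 2 + X 1 ^ 2) hq).congr
    fun x _ => ?_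
  simp [map_add, map_pow, MvPolynomial.aeval_X]

/-- **THE CORNER OBSTRUCTION.** No function continuous on the closed unit square agrees with
`2x²/(x²+y²)` on the open square: along the diagonal `(s,s)` the values are `1`, along the parabola
`(s,s²)` they are `2/(1+s²) → 2`, and both curves run inside the open square into the corner `0`.
Hence "bounded + continuous on the OPEN cube" (free from cylindrical decomposition) is strictly weaker
than the crux's "continuous on the CLOSED cube" at the level of single representations; the gap is
closed only by a further move. [folklore] -/
theorem not_exists_continuousOn_closedSquare_extension :
    ¬ ∃ G : (Fin 2 → ℝ) → ℝ, ContinuousOn G (Set.pi Set.univ (fun _ : Fin 2 => Set.Icc (0:ℝ) 1)) ∧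
      EqOn G (fun x => 2 * x 0 ^ 2 / (x 0 ^ 2 + x 1 ^ 2))
        (Set.pi Set.univ (fun _ : Fin 2 => Set.Ioo (0:ℝ) 1)) := by
  rintro ⟨G, hG, hEq⟩
  set Q : Set (Fin 2 → ℝ) := Set.pi Set.univ (fun _ : Fin 2 => Set.Icc (0:ℝ) 1) with hQ
  set U : Set (Fin 2 → ℝ) := Set.pi Set.univ (fun _ : Fin 2 => Set.Ioo (0:ℝ) 1) with hU
  have h0Q : (0 : Fin 2 → ℝ) ∈ Q := by
    rw [hQ, Set.mem_univ_pi]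
    intro i
    exact ⟨le_rfl, zero_le_one⟩
  have hcont : Tendsto G (𝓝[Q] 0) (𝓝 (G 0)) := hG 0 h0Q
  -- two curves into the corner, inside the open square for `s ∈ (0,1)`
  have hIoo : ∀ᶠ s in 𝓝[>] (0:ℝ), s ∈ Ioo (0:ℝ) 1 :=
    Ioo_mem_nhdsGT zero_lt_one
  have hγ₁U : ∀ s ∈ Ioo (0:ℝ) 1, (![s, s] : Fin 2 → ℝ) ∈ U := by
    intro s hs
    rw [hU, Set.mem_univ_pi]
    intro i
    fin_cases i <;> simpa using hs
  have hγ₂U : ∀ s ∈ Ioo (0:ℝ) 1, (![s, s ^ 2] : Fin 2 → ℝ) ∈ U := by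
    intro s hs
    rw [hU, Set.mem_univ_pi]
    intro i
    fin_cases i
    · simpa using hs
    · have hs0 := hs.1
      have hs1 := hs.2
      simp only [Fin.mk_one, Matrix.cons_val_one, Matrix.cons_val_fin_one, mem_Ioo]
      exact ⟨by positivity, by nlinarith⟩
  have hUQ : U ⊆ Q := by
    rw [hU, hQ]
    exact Set.pi_mono fun _ _ => Ioo_subset_Icc_self
  -- the curves tend to the corner within `Q`
  have hγ₁ : Tendsto (fun s : ℝ => (![s, s] : Fin 2 → ℝ)) (𝓝[>] 0) (𝓝[Q] 0) := by
    refine tendsto_nhdsWithin_iff.2 ⟨?_, hIoo.mono fun s hs => hUQ (hγ₁U s hs)⟩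
    have hc : Continuous (fun s : ℝ => (![s, s] : Fin 2 → ℝ)) := by fun_prop
    have h := hc.tendsto 0
    have h00 : (![(0:ℝ), 0] : Fin 2 → ℝ) = 0 := by
      ext i; fin_cases i <;> simp
    rw [h00] at h
    exact h.mono_left nhdsWithin_le_nhds
  have hγ₂ : Tendsto (fun s : ℝ => (![s, s ^ 2] : Fin 2 → ℝ)) (𝓝[>] 0) (𝓝[Q] 0) := by
    refine tendsto_nhdsWithin_iff.2 ⟨?_, hIoo.mono fun s hs => hUQ (hγ₂U s hs)⟩
    have hc : Continuous (fun s : ℝ => (![s, s ^ 2] : Fin 2 → ℝ)) := by fun_prop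
    have h := hc.tendsto 0
    have h00 : (![(0:ℝ), 0 ^ 2] : Fin 2 → ℝ) = 0 := by
      ext i; fin_cases i <;> simp
    rw [h00] at h
    exact h.mono_left nhdsWithin_le_nhds
  -- along the diagonal `G = 1`, along the parabola `G = 2/(1+s²)`
  have h1 : Tendsto (fun s : ℝ => G ![s, s]) (𝓝[>] 0) (𝓝 1) := by
    refine (tendsto_const_nhds (x := (1:ℝ))).congr' (hIoo.mono fun s hs => ?_)
    show (1:ℝ) = G ![s, s]
    rw [hEq (hγ₁U s hs)]
    have hs0 : s ≠ 0 := hs.1.ne'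
    simp only [Matrix.cons_val_zero, Matrix.cons_val_one, Matrix.cons_val_fin_one]
    field_simp
    ring
  have h2 : Tendsto (fun s : ℝ => G ![s, s ^ 2]) (𝓝[>] 0) (𝓝 2) := by
    have hlim : Tendsto (fun s : ℝ => 2 / (1 + s ^ 2)) (𝓝[>] 0) (𝓝 2) := by
      have hc : Continuous (fun s : ℝ => 2 / (1 + s ^ 2)) :=
        Continuous.div continuous_const (by fun_prop) fun s => by positivity
      have h := hc.tendsto 0
      norm_num at h
      exact h.mono_left nhdsWithin_le_nhds
    refine hlim.congr' (hIoo.mono fun s hs => ?_)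
    show 2 / (1 + s ^ 2) = G ![s, s ^ 2]
    rw [hEq (hγ₂U s hs)]
    have hs0 : s ≠ 0 := hs.1.ne'
    simp only [Matrix.cons_val_zero, Matrix.cons_val_one, Matrix.cons_val_fin_one]
    field_simp
  have e1 : G 0 = 1 := tendsto_nhds_unique (hcont.comp hγ₁) h1
  have e2 : G 0 = 2 := tendsto_nhds_unique (hcont.comp hγ₂) h2
  linarith

end Summit.KontsevichZagierPeriods.UnfoldedStokes.ContinuousCubificationNegative

end
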